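import Mathlib
import Summits.CriticalPhenomena.Ising3DConformalLimit.Theorems.FKParityRobustnessIndependentStrandsJoinStubPairSplitAux
import Literature.Probability.LatticeModels.LoopO1
import Literature.Probability.LatticeModels.ModifiedSimonInequality
import Literature.Combinatorics.SimpleGraph.CycleSpaceSeparators
import HarnessLib

/-!
# Crux `IndependentStrandsJoin` (stmt-CriticalPhenomena-14625), line Sketch — stub `stub_pairSplit`

Route `FKParityRobustness`, sub-problem `Ising3DConformalLimit`; support file (theorem-only) for the
line `Sketch` of the crux `IndependentStrandsJoin`.

**What the stub says — the pair-split deletion identity (★).**  On a finite simple graph `G` with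
`t = tanh β`, four marked vertices `a : Fin 4 → V`, `𝒯(B) = tJoins G univ B` and `v ↝_F w` the
reachability inside the edge set `F` (`(fromEdgeSet ↑F).Reachable v w`):

  `Σ_{F ∈ 𝒯(a₀a₁) : a₀ ↝̸_F a₂, a₀ ↝̸_F a₃} t^{|F|} · ⟨σ_{a₂}σ_{a₃}⟩^free_{G, {v | a₀ ↝̸_F v}; β, 0}
     = Σ_{D ∈ 𝒯(a₀a₁a₂a₃) : a₀ ↝̸_D a₂, a₀ ↝̸_D a₃} t^{|D|}`,

i.e. summing the free pair correlation on the DEPLETED volume (couplings touching the `a₀`-cluster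
switched off) against the one-pair strand weights reproduces the four-source loop sum restricted
to the split `01|23`.

**Proof.**  Group both sides by `K =` the edges of the `a₀`-component of the configuration (its
`a₀`-cluster `{d ∈ F | ∃ w ∈ d, a₀ ↝_F w}`; `sum_clean_eq_sum_fibres`).  The admissible `K` (the
cluster index set) are the self-clustered `K ⊆ E(G)` with odd set `{a₀, a₁}` reaching neither `a₂`
nor `a₃` (`cluster_mem_index`; that `a₁` IS reached is the handshake inside the `a₀`-cluster,
`exists_reachable_odd_of_odd`).  Over a fixed `K` with depleted volume `Λ = {v | a₀ ↝̸_K v}`, the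
map `F ↦ F ∖ K` is a bijection from the fibre of `K` in `𝒯(S₀ ∪ T)` onto the edge sets
`R ⊆ edgesIn G Λ` with `oddVerts Λ R = T`, inverse `R ↦ K ∪ R` (`fibre_sum` of the auxiliary
file `…StubPairSplitAux.lean`, registered there as the auxiliary stub `stub_pairSplitAux`; `T = ∅` on
the pair side, `T = {a₂, a₃}` on the four-source side), and the depleted volume of `K ∪ R` is `Λ`.  By the high-temperature expansion `⟨σ_{a₂}σ_{a₃}⟩^free_Λ = g_Λ({a₂,a₃}) / g_Λ(∅)`
(`isingCorr_free_eq_hteSum_div`) the pair-side fibre sums to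
`t^{|K|} g_Λ(∅) · g_Λ({a₂,a₃}) / g_Λ(∅) = t^{|K|} g_Λ({a₂,a₃})` (`fibre_pair_side`), and so does the
four-source fibre (`fibre_four_side`); summing over `K` gives (★) (`pairSplit_identity`), and
`stub_pairSplit` is (★) after `univ.image a = {a 0, a 1} ∪ {a 2, a 3}`.  The hypotheses `0 ≤ β` and
`a` injective of the registered signature are not needed.

Ported from the kernel-checked `pairSplit_identity` / `pairSplitDeletionIdentity_holds` of the
standing disprover's work file `Cruxes/StrandShadow/Disproof.lean`
(refuter-cdisprove-stmt-CriticalPhenomena-14626-0), with its `def`s `Rch`, `clusterEdges`, `edeg`,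
`dVol`, `clusterIndex` written out (so the file declares theorems only).

References: H. Duminil-Copin, *Lectures on the Ising and Potts models on the hypercubic lattice*
(2017), §2.2.1 (high-temperature expansion) [DuminilCopinECM2018]; U. T. Hansen, J. Jiang,
F. R. Klausen, arXiv:2506.10765, §2 (sourced even subgraphs) [HansenJiangKlausen2025];
M. Aizenman, Comm. Math. Phys. 86 (1982), §5 (conditioning on a cluster) [AizenmanCMP1982].
-/

noncomputable section

open Finset SimpleGraph
open Literature.Probability.LatticeModels
open scoped Classical BigOperators

namespace Summit.CriticalPhenomena.Ising3DConformalLimit.Theorems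

namespace StubPairSplit

-- adapted from Cruxes/StrandShadow/Disproof.lean (refuter-cdisprove-stmt-CriticalPhenomena-14626-0)
-- §4a (sections Assembly and Costume), with `Rch`, `clusterEdges`, `edeg`, `dVol`, `clusterIndex`
-- written out.

variable {V : Type*} [Fintype V] [DecidableEq V] (G : SimpleGraph V) [DecidableRel G.Adj]

/-! ### Assembly of (★) over the cluster index set -/

/-- In a `T`-join whose terminals other than `a₀, a₁` are unreachable from `a₀`, the terminal
`a₁` IS reachable (handshake inside the `a₀`-cluster). -/
theorem rch_a1 {S' : Finset V} {a₀ a₁ : V} {F : Finset (Sym2 V)}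
    (hS' : ∀ v ∈ S', (fromEdgeSet ↑F).Reachable a₀ v → v = a₀ ∨ v = a₁)
    (hF : F ∈ tJoins G Set.univ S') (ha₀ : a₀ ∈ S') : (fromEdgeSet ↑F).Reachable a₀ a₁ := by
  rw [mem_tJoins_univ] at hF
  obtain ⟨hFG, hFodd⟩ := hF
  have hdiag : ∀ e ∈ F, ¬ e.IsDiag := fun e he =>
    G.not_isDiag_of_mem_edgeSet (mem_edgeFinset.1 (hFG he))
  obtain ⟨w, hw, hr, hodd⟩ :=
    Literature.Combinatorics.SimpleGraph.CycleSpace.exists_reachable_odd_of_odd F hdiag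
      ((hFodd a₀).2 ha₀)
  rcases hS' w ((hFodd w).1 hodd) hr with h | h
  · exact absurd h hw
  · exact h ▸ hr

/-- The `a₀`-cluster of a clean `T`-join lies in the cluster index set: it is a self-clustered
subset of `E(G)` with odd set `{a₀, a₁}` reaching neither `a₂` nor `a₃`. -/
theorem cluster_mem_index {S' : Finset V} {a₀ a₁ a₂ a₃ : V}
    (ha₀ : a₀ ∈ S') (ha₁ : a₁ ∈ S') (hS' : ∀ v ∈ S', v ≠ a₀ → v ≠ a₁ → v = a₂ ∨ v = a₃)
    {F : Finset (Sym2 V)} (hF : F ∈ tJoins G Set.univ S')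
    (h2 : ¬ (fromEdgeSet ↑F).Reachable a₀ a₂) (h3 : ¬ (fromEdgeSet ↑F).Reachable a₀ a₃) :
    {d ∈ F | ∃ w ∈ d, (fromEdgeSet ↑F).Reachable a₀ w} ∈
      G.edgeFinset.powerset.filter (fun K : Finset (Sym2 V) =>
        {d ∈ K | ∃ w ∈ d, (fromEdgeSet ↑K).Reachable a₀ w} = K ∧
        (∀ v, Odd #{d ∈ K | v ∈ d} ↔ v ∈ ({a₀, a₁} : Finset V)) ∧
        ¬ (fromEdgeSet ↑K).Reachable a₀ a₂ ∧ ¬ (fromEdgeSet ↑K).Reachable a₀ a₃) := by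
  have hreach : ∀ v ∈ S', (fromEdgeSet ↑F).Reachable a₀ v → v = a₀ ∨ v = a₁ := by
    intro v hv hr
    by_cases h0 : v = a₀
    · exact Or.inl h0
    by_cases h1 : v = a₁
    · exact Or.inr h1
    rcases hS' v hv h0 h1 with rfl | rfl
    · exact absurd hr h2
    · exact absurd hr h3
  have h1 : (fromEdgeSet ↑F).Reachable a₀ a₁ := rch_a1 G hreach hF ha₀
  rw [mem_tJoins_univ] at hF
  obtain ⟨hFG, hFodd⟩ := hF
  rw [mem_filter, mem_powerset]
  refine ⟨(cluster_subset F a₀).trans hFG, cluster_idem F a₀, fun v => ?_, ?_, ?_⟩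
  · by_cases hv : (fromEdgeSet ↑F).Reachable a₀ v
    · rw [edeg_cluster_eq hv, hFodd v, mem_insert, mem_singleton]
      exact ⟨fun hvS => hreach v hvS hv, fun h => h.elim (fun h => h ▸ ha₀) (fun h => h ▸ ha₁)⟩
    · rw [edeg_cluster_eq_zero hv, mem_insert, mem_singleton]
      refine ⟨fun h => absurd h Nat.not_odd_zero, ?_⟩
      rintro (rfl | rfl)
      · exact absurd (Reachable.refl _) hv
      · exact absurd h1 hv
  · rwa [rch_cluster_iff]
  · rwa [rch_cluster_iff]

/-- **Outer decomposition**: a clean sum over `T`-joins is a sum over the cluster index set of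
fibre sums. -/
theorem sum_clean_eq_sum_fibres {S' : Finset V} {a₀ a₁ a₂ a₃ : V}
    (ha₀ : a₀ ∈ S') (ha₁ : a₁ ∈ S') (hS' : ∀ v ∈ S', v ≠ a₀ → v ≠ a₁ → v = a₂ ∨ v = a₃)
    (g : Finset (Sym2 V) → ℝ) :
    ∑ F ∈ (tJoins G Set.univ S').filter (fun F : Finset (Sym2 V) =>
        ¬ (fromEdgeSet ↑F).Reachable a₀ a₂ ∧ ¬ (fromEdgeSet ↑F).Reachable a₀ a₃), g F =
      ∑ K ∈ G.edgeFinset.powerset.filter (fun K : Finset (Sym2 V) =>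
          {d ∈ K | ∃ w ∈ d, (fromEdgeSet ↑K).Reachable a₀ w} = K ∧
          (∀ v, Odd #{d ∈ K | v ∈ d} ↔ v ∈ ({a₀, a₁} : Finset V)) ∧
          ¬ (fromEdgeSet ↑K).Reachable a₀ a₂ ∧ ¬ (fromEdgeSet ↑K).Reachable a₀ a₃),
        ∑ F ∈ (tJoins G Set.univ S').filter (fun F : Finset (Sym2 V) =>
          {d ∈ F | ∃ w ∈ d, (fromEdgeSet ↑F).Reachable a₀ w} = K), g F := by
  have hmaps := fun (F : Finset (Sym2 V)) (hF : F ∈ (tJoins G Set.univ S').filter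
      (fun F : Finset (Sym2 V) =>
        ¬ (fromEdgeSet ↑F).Reachable a₀ a₂ ∧ ¬ (fromEdgeSet ↑F).Reachable a₀ a₃)) =>
    cluster_mem_index G ha₀ ha₁ hS' (mem_filter.1 hF).1 (mem_filter.1 hF).2.1 (mem_filter.1 hF).2.2
  rw [← Finset.sum_fiberwise_of_maps_to hmaps g]
  refine Finset.sum_congr rfl fun K hK => ?_
  apply Finset.sum_congr ?_ (fun _ _ => rfl)
  obtain ⟨-, -, -, hK2, hK3⟩ := mem_filter.1 hK
  ext F
  simp only [mem_filter]
  constructor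
  · rintro ⟨⟨hF, -⟩, hcl⟩; exact ⟨hF, hcl⟩
  · rintro ⟨hF, hcl⟩
    refine ⟨⟨hF, ?_, ?_⟩, hcl⟩
    · rw [← rch_cluster_iff, hcl]; exact hK2
    · rw [← rch_cluster_iff, hcl]; exact hK3

/-- The terminals `a₂, a₃` lie in the depleted volume of an admissible cluster. -/
theorem pair_subset_dVol {a₀ a₂ a₃ : V} {K : Finset (Sym2 V)}
    (hK2 : ¬ (fromEdgeSet ↑K).Reachable a₀ a₂) (hK3 : ¬ (fromEdgeSet ↑K).Reachable a₀ a₃) :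
    ({a₂, a₃} : Finset V) ⊆ (univ.filter fun w => ¬ (fromEdgeSet ↑K).Reachable a₀ w) := by
  intro v hv
  rw [mem_insert, mem_singleton] at hv
  rcases hv with rfl | rfl
  · exact mem_dVol.2 hK2
  · exact mem_dVol.2 hK3

/-- **Fibre evaluation, pair side**: over the fibre of an admissible `K`,
`Σ t^|F| ⟨σ₂σ₃⟩_{depl F} = t^|K| · g_Λ({a₂,a₃})` (high-temperature expansion on the depleted
volume `Λ` of `K`). -/
theorem fibre_pair_side {a₀ a₁ a₂ a₃ : V} {K : Finset (Sym2 V)} (hKG : K ⊆ G.edgeFinset)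
    (hKself : {d ∈ K | ∃ w ∈ d, (fromEdgeSet ↑K).Reachable a₀ w} = K)
    (hKodd : ∀ v, Odd #{d ∈ K | v ∈ d} ↔ v ∈ ({a₀, a₁} : Finset V))
    (hK2 : ¬ (fromEdgeSet ↑K).Reachable a₀ a₂) (hK3 : ¬ (fromEdgeSet ↑K).Reachable a₀ a₃)
    (β : ℝ) :
    ∑ F ∈ (tJoins G Set.univ {a₀, a₁}).filter (fun F : Finset (Sym2 V) =>
        {d ∈ F | ∃ w ∈ d, (fromEdgeSet ↑F).Reachable a₀ w} = K),
        Real.tanh β ^ F.card *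
          isingCorr G (univ.filter fun w => ¬ (fromEdgeSet ↑F).Reachable a₀ w) β 0 .free {a₂, a₃} =
      Real.tanh β ^ K.card *
        hteSum G (univ.filter fun w => ¬ (fromEdgeSet ↑K).Reachable a₀ w) (Real.tanh β)
          {a₂, a₃} := by
  have hfib := fibre_sum G hKG hKself hKodd (T := ∅) (empty_subset _) (fun F =>
    Real.tanh β ^ F.card *
      isingCorr G (univ.filter fun w => ¬ (fromEdgeSet ↑F).Reachable a₀ w) β 0 .free {a₂, a₃})
  rw [union_empty] at hfib
  rw [hfib]
  set Λ := (univ.filter fun w => ¬ (fromEdgeSet ↑K).Reachable a₀ w) with hΛ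
  have hA : ({a₂, a₃} : Finset V) ⊆ Λ := pair_subset_dVol hK2 hK3
  have hne : hteSum G Λ (Real.tanh β) ∅ ≠ 0 := (hteSum_empty_pos G Λ β).ne'
  have hsummand : ∀ R ∈ (edgesIn G Λ).powerset.filter (fun R => oddVerts Λ R = ∅),
      Real.tanh β ^ (K ∪ R).card *
          isingCorr G (univ.filter fun w => ¬ (fromEdgeSet ↑(K ∪ R)).Reachable a₀ w) β 0 .free
            {a₂, a₃} =
        Real.tanh β ^ K.card * (hteSum G Λ (Real.tanh β) {a₂, a₃} / hteSum G Λ (Real.tanh β) ∅) *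
          Real.tanh β ^ R.card := by
    intro R hR
    rw [mem_filter, mem_powerset] at hR
    have havoid : ∀ e ∈ R, ∀ v ∈ e, ¬ (fromEdgeSet ↑K).Reachable a₀ v := fun e he v hv =>
      mem_dVol.1 ((mem_edgesIn_iff.1 (hR.1 he)).2 v hv)
    rw [dVol_union_eq havoid, card_union_of_disjoint (disjoint_of_avoid hKself havoid), pow_add,
      ← hΛ, isingCorr_free_eq_hteSum_div G Λ β hA]
    ring
  rw [Finset.sum_congr rfl hsummand, ← Finset.mul_sum]
  have hZ : ∑ R ∈ (edgesIn G Λ).powerset.filter (fun R => oddVerts Λ R = ∅),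
      Real.tanh β ^ R.card = hteSum G Λ (Real.tanh β) ∅ := rfl
  rw [hZ]
  field_simp

/-- **Fibre evaluation, four-source side**: over the fibre of an admissible `K`,
`Σ t^|F| = t^|K| · g_Λ({a₂,a₃})`. -/
theorem fibre_four_side {a₀ a₁ a₂ a₃ : V} {K : Finset (Sym2 V)} (hKG : K ⊆ G.edgeFinset)
    (hKself : {d ∈ K | ∃ w ∈ d, (fromEdgeSet ↑K).Reachable a₀ w} = K)
    (hKodd : ∀ v, Odd #{d ∈ K | v ∈ d} ↔ v ∈ ({a₀, a₁} : Finset V))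
    (hK2 : ¬ (fromEdgeSet ↑K).Reachable a₀ a₂) (hK3 : ¬ (fromEdgeSet ↑K).Reachable a₀ a₃)
    (t : ℝ) :
    ∑ F ∈ (tJoins G Set.univ ({a₀, a₁} ∪ {a₂, a₃})).filter (fun F : Finset (Sym2 V) =>
        {d ∈ F | ∃ w ∈ d, (fromEdgeSet ↑F).Reachable a₀ w} = K), t ^ F.card =
      t ^ K.card *
        hteSum G (univ.filter fun w => ¬ (fromEdgeSet ↑K).Reachable a₀ w) t {a₂, a₃} := by
  rw [fibre_sum G hKG hKself hKodd (pair_subset_dVol hK2 hK3) (fun F => t ^ F.card)]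
  have hsummand : ∀ R ∈ (edgesIn G (univ.filter fun w => ¬ (fromEdgeSet ↑K).Reachable a₀ w)
      ).powerset.filter (fun R =>
        oddVerts (univ.filter fun w => ¬ (fromEdgeSet ↑K).Reachable a₀ w) R = {a₂, a₃}),
      t ^ (K ∪ R).card = t ^ K.card * t ^ R.card := by
    intro R hR
    rw [mem_filter, mem_powerset] at hR
    have havoid : ∀ e ∈ R, ∀ v ∈ e, ¬ (fromEdgeSet ↑K).Reachable a₀ v := fun e he v hv =>
      mem_dVol.1 ((mem_edgesIn_iff.1 (hR.1 he)).2 v hv)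
    rw [card_union_of_disjoint (disjoint_of_avoid hKself havoid), pow_add]
  rw [Finset.sum_congr rfl hsummand, ← Finset.mul_sum]
  rfl

/-- **(★), abstract form** on a finite graph, for any four vertices `a₀ a₁ a₂ a₃`. -/
theorem pairSplit_identity (a₀ a₁ a₂ a₃ : V) (β : ℝ) :
    ∑ F ∈ (tJoins G Set.univ {a₀, a₁}).filter (fun F : Finset (Sym2 V) =>
        ¬ (fromEdgeSet ↑F).Reachable a₀ a₂ ∧ ¬ (fromEdgeSet ↑F).Reachable a₀ a₃),
        Real.tanh β ^ F.card *
          isingCorr G (univ.filter fun w => ¬ (fromEdgeSet ↑F).Reachable a₀ w) β 0 .free {a₂, a₃} =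
      ∑ F ∈ (tJoins G Set.univ ({a₀, a₁} ∪ {a₂, a₃})).filter (fun F : Finset (Sym2 V) =>
        ¬ (fromEdgeSet ↑F).Reachable a₀ a₂ ∧ ¬ (fromEdgeSet ↑F).Reachable a₀ a₃),
        Real.tanh β ^ F.card := by
  have hS₁ : ∀ v ∈ ({a₀, a₁} : Finset V), v ≠ a₀ → v ≠ a₁ → v = a₂ ∨ v = a₃ := by
    intro v hv h0 h1
    rw [mem_insert, mem_singleton] at hv
    rcases hv with rfl | rfl
    · exact absurd rfl h0
    · exact absurd rfl h1
  have hS₂ : ∀ v ∈ ({a₀, a₁} ∪ {a₂, a₃} : Finset V), v ≠ a₀ → v ≠ a₁ → v = a₂ ∨ v = a₃ := by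
    intro v hv h0 h1
    rw [mem_union, mem_insert, mem_singleton, mem_insert, mem_singleton] at hv
    rcases hv with (rfl | rfl) | h
    · exact absurd rfl h0
    · exact absurd rfl h1
    · exact h
  rw [sum_clean_eq_sum_fibres G (by simp) (by simp) hS₁,
    sum_clean_eq_sum_fibres G (by simp) (by simp) hS₂]
  refine Finset.sum_congr rfl fun K hK => ?_
  obtain ⟨hKG, hKself, hKodd, hK2, hK3⟩ := mem_filter.1 hK
  rw [fibre_pair_side G (mem_powerset.1 hKG) hKself hKodd hK2 hK3,
    fibre_four_side G (mem_powerset.1 hKG) hKself hKodd hK2 hK3]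

end StubPairSplit

/-- **Stub `stub_pairSplit` of the line `Sketch` of `IndependentStrandsJoin` — the pair-split
deletion identity (★)** (registered signature, verbatim): on a finite graph, summing the free pair
correlation `⟨σ_{a 2}σ_{a 3}⟩` on the depleted volume `{v | a 0 ↝̸_F v}` against the clean
one-pair strand weights `tanh β ^ |F|`, `F ∈ 𝒯(a 0, a 1)`, gives the clean four-source loop sum.
The hypotheses `0 ≤ β` and `Function.Injective a` are not used. -/
theorem stub_pairSplit :
    ∀ (V : Type) [Fintype V] [DecidableEq V] (G : SimpleGraph V) [DecidableRel G.Adj] (β : ℝ),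
      0 ≤ β → ∀ a : Fin 4 → V, Function.Injective a →
      (∑ F ∈ (tJoins G Set.univ {a 0, a 1}).filter (fun F : Finset (Sym2 V) =>
            ¬ (SimpleGraph.fromEdgeSet (↑F : Set (Sym2 V))).Reachable (a 0) (a 2) ∧
            ¬ (SimpleGraph.fromEdgeSet (↑F : Set (Sym2 V))).Reachable (a 0) (a 3)),
          Real.tanh β ^ F.card *
            isingCorr G (Finset.univ.filter (fun v : V =>
              ¬ (SimpleGraph.fromEdgeSet (↑F : Set (Sym2 V))).Reachable (a 0) v)) β 0 .free {a 2, a 3})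
        = ∑ D ∈ (tJoins G Set.univ (Finset.univ.image a)).filter (fun D : Finset (Sym2 V) =>
            ¬ (SimpleGraph.fromEdgeSet (↑D : Set (Sym2 V))).Reachable (a 0) (a 2) ∧
            ¬ (SimpleGraph.fromEdgeSet (↑D : Set (Sym2 V))).Reachable (a 0) (a 3)),
          Real.tanh β ^ D.card := by
  intro V _ _ G _ β _ a _
  have himg : (Finset.univ.image a : Finset V) = {a 0, a 1} ∪ {a 2, a 3} := by
    ext v
    simp only [Finset.mem_image, Finset.mem_univ, true_and, Finset.mem_union, Finset.mem_insert,
      Finset.mem_singleton]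
    constructor
    · rintro ⟨i, rfl⟩
      fin_cases i <;> simp
    · rintro ((rfl | rfl) | (rfl | rfl)) <;> exact ⟨_, rfl⟩
  rw [himg]
  exact StubPairSplit.pairSplit_identity G (a 0) (a 1) (a 2) (a 3) β

end Summit.CriticalPhenomena.Ising3DConformalLimit.Theorems

end
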